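import Summits.FinalStateConjecture.FinalStateConjecture.Statement
import Literature.Geometry.Lorentzian.FlatChartKretschmannBound

/-!
# Solo (blind) — late flat leaves are curvature-small (Step 1 of Theorem B‴)

Kernel form of Step 1 of Theorems B / B‴ of `paper/focal-exceptional.md` and
`paper/rigidity-appendix.md` §H.6 (soloist `solo-FinalStateConjecture-blind`), over the REAL
structure `Literature.Geometry.Lorentzian.FinalStateDecomposition`: since the `Cᵏ` deviation
(`k ≥ 2`) of the flat (radiation-zone) chart from `η` on the slabs `{x⁰ = τ} ∩ U₀` tends to `0`
(field `tendsto_deviationCk_flat`), the Kretschmann scalar `K₁ = R_{abcd}R^{abcd}` of the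
development is eventually `≤ κ` on the flat leaves, for every `κ > 0`
(`soloBlind_eventually_abs_kretschmannAt_flat_le`), by the pointwise bound
`|K₁| ≤ 4⁵·42²·8¹²·ε²` on `ε`-flat charts
(`Literature.Geometry.Lorentzian.Spacetime.abs_kretschmannAt_le_of_deviationCk_le`).
Consequently a set `B` on which `|K₁| > κ` is disjoint from the flat chart's image of the late
flat region `{x⁰ > τ₁} ∩ U₀` for all large `τ₁`
(`soloBlind_exists_disjoint_flat_lateRegion_of_lt_abs_kretschmannAt`) — this is exactly the
`separation` hypothesis `Disjoint B (Ψ₀ '' lateRegion τ₁)` of the landed causal skeleton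
`soloBlind_focal_contradiction` (`Theorems/SoloBlindFocal.lean`), now discharged from a
curvature lower bound on `B` alone. What stays analytic: the curvature spike itself
(`|K₁| ≥ 2` near the focal events, Prop. 3 / (A″b) of the paper) and the late achronal leaf
(Theorem R″ + horizontality, App. H).

References: B. Kotschwar, *A short proof of backward uniqueness for some geometric evolution
equations*, §1.1 (8) (curvature in terms of metric jets) [Kotschwar2014];
M. Dafermos, G. Holzegel, I. Rodnianski, M. Taylor, arXiv:2104.08222, §1 (late slabs).
-/

noncomputable section

open Literature.Geometry.Lorentzian Set Filter
open scoped Manifold ContDiff Topology ENNReal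

set_option linter.dupNamespace false

namespace Summit.FinalStateConjecture.FinalStateConjecture.Theorems

universe u

variable {𝓢 : Spacetime.{u} 4} {O : Set 𝓢.carrier} {k : ℕ}

/-- **Late flat leaves are curvature-small.** For a final state decomposition converging in
`Cᵏ`, `k ≥ 2`, and every `κ > 0`: for all large chart times `τ`, the Kretschmann scalar of the
development satisfies `|K₁(Ψ₀ x)| ≤ κ` at every point `x` of the flat slab `{x⁰ = τ} ∩ U₀`.
Step 1 of Theorem B‴ (App. H.6 of the soloist's paper); the pointwise input is
Kotschwar, §1.1 (8) via `abs_kretschmannAt_le_of_deviationCk_le`. [cite: Kotschwar2014] -/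
theorem soloBlind_eventually_abs_kretschmannAt_flat_le (d : FinalStateDecomposition 𝓢 O k)
    (hk : 2 ≤ k) {κ : ℝ} (hκ : 0 < κ) :
    ∀ᶠ τ in atTop, ∀ x ∈ (Minkowski.backgroundOn d.flatDomain).timeSlab τ,
      |𝓢.kretschmannAt (d.flatChart x)| ≤ κ := by
  set C : ℝ := 4 ^ 5 * 42 ^ 2 * 8 ^ 12 with hC
  have hC0 : 0 < C := by rw [hC]; positivity
  set ε : ℝ := min 16⁻¹ (Real.sqrt (κ / C)) with hε
  have hε0 : 0 < ε := lt_min (by norm_num) (Real.sqrt_pos.2 (div_pos hκ hC0))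
  have hε16 : ε ≤ 16⁻¹ := min_le_left _ _
  have hεsq : C * ε ^ 2 ≤ κ := by
    have h1 : ε ≤ Real.sqrt (κ / C) := min_le_right _ _
    have h2 : ε ^ 2 ≤ κ / C := by
      calc ε ^ 2 ≤ (Real.sqrt (κ / C)) ^ 2 := by gcongr
        _ = κ / C := Real.sq_sqrt (div_pos hκ hC0).le
    calc C * ε ^ 2 ≤ C * (κ / C) := by gcongr
      _ = κ := by field_simp
  have hdev : ∀ᶠ τ in atTop,
      𝓢.deviationCk (Minkowski.backgroundOn d.flatDomain) d.flatChart 2 τ ≤ ENNReal.ofReal ε := by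
    have h2 : Tendsto
        (fun τ ↦ 𝓢.deviationCk (Minkowski.backgroundOn d.flatDomain) d.flatChart 2 τ)
        atTop (𝓝 0) :=
      tendsto_of_tendsto_of_tendsto_of_le_of_le tendsto_const_nhds d.tendsto_deviationCk_flat
        (fun _ ↦ zero_le)
        fun τ ↦ 𝓢.deviationCk_mono (Minkowski.backgroundOn d.flatDomain) d.flatChart hk τ
    exact ENNReal.tendsto_nhds_zero.1 h2 _ (ENNReal.ofReal_pos.2 hε0)
  filter_upwards [hdev] with τ hτ x hx
  calc |𝓢.kretschmannAt (d.flatChart x)| ≤ 4 ^ 5 * 42 ^ 2 * 8 ^ 12 * ε ^ 2 :=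
      𝓢.abs_kretschmannAt_le_of_deviationCk_le d.flatChart d.isLateChart_flat.contMDiff hε0.le
        hε16 hτ hx
    _ = C * ε ^ 2 := by rw [hC]
    _ ≤ κ := hεsq

/-- **Curvature separates spikes from late flat leaves.** For a final state decomposition
converging in `Cᵏ`, `k ≥ 2`, and `κ > 0`, there is a chart time `τ₁` such that every set `B` of
the spacetime on which `|K₁| > κ` is disjoint from the flat chart's image of the late flat region
`{x⁰ > τ} ∩ U₀` for every `τ ≥ τ₁` — the `separation` hypothesis of
`soloBlind_focal_contradiction`, discharged from a curvature lower bound on `B`.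
Step 1 of Theorem B‴ (App. H.6 of the soloist's paper). [cite: Kotschwar2014] -/
theorem soloBlind_exists_disjoint_flat_lateRegion_of_lt_abs_kretschmannAt
    (d : FinalStateDecomposition 𝓢 O k) (hk : 2 ≤ k) {κ : ℝ} (hκ : 0 < κ) :
    ∃ τ₁ : ℝ, ∀ τ, τ₁ ≤ τ → ∀ B : Set 𝓢.carrier,
      (∀ q ∈ B, κ < |𝓢.kretschmannAt q|) →
        Disjoint B (d.flatChart '' (Minkowski.backgroundOn d.flatDomain).lateRegion τ) := by
  obtain ⟨τ₁, hτ₁⟩ := eventually_atTop.1 (soloBlind_eventually_abs_kretschmannAt_flat_le d hk hκ)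
  refine ⟨τ₁, fun τ hτ B hB ↦ disjoint_left.2 fun q hqB hqL ↦ ?_⟩
  obtain ⟨x, hx, rfl⟩ := hqL
  have hxt : τ < (Minkowski.backgroundOn d.flatDomain).time x.1 := hx
  have hle : |𝓢.kretschmannAt (d.flatChart x)| ≤ κ :=
    hτ₁ _ (hτ.trans hxt.le) x (ModelBackground.mem_timeSlab.2 rfl)
  exact (not_le.2 (hB _ hqB)) hle

end Summit.FinalStateConjecture.FinalStateConjecture.Theorems

end
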